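import Summits.ResolutionOfSingularities.ResolutionOfSingularities.Theses.Valuative
import Literature.AlgebraicGeometry.Resolution.RankOneReductionProofs
import HarnessLib

/-!
# The birational exit of line `pfaff-line-log-final-forms` for the crux `Valuative.LuAlphaPTorsor`
# (stmt-ResolutionOfSingularities-0641): stub `stub_birationalExit`

Setting: `k` a field of characteristic `p`, `K ⊇ k` a field, `O` a valuation ring of `K`,
`A₁ ⊆ O` a finitely generated `k`-subalgebra whose local ring `R = (A₁)_𝔭` at the centre
`𝔭 = 𝔪_O ∩ A₁` is regular, `t ∈ K` with `t ^ p ∈ A₁` and `Frac (A₁[t]) = K`.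

**Claim** (`stub_birationalExit`). If `t ^ p` is a `p`-th power `c ^ p` in the abstract local
ring `R = Localization.AtPrime 𝔭`, then `A := A₁[t]` is a finitely generated model with
`A₁ ≤ A ∋ t`, `A ⊆ O`, `Frac A = K`, regular at the centre.

Proof. The universal map `φ : R → K` (elements outside `𝔭` are nonzero, hence units of `K`)
sends `c ^ p` to `t ^ p`, so `φ c ^ p = t ^ p` in the field `K` of characteristic `p`, whence
`t = φ c = a / s` with `a, s ∈ A₁`, `ν(s) = 1` (injectivity of Frobenius on a reduced ring).
Consequently `Frac A₁ = Frac (A₁[t]) = K`, `t` lies in the local ring `Λ₁ = (A₁)_𝔭 ⊆ K`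
realised inside `K`, so `A₁ ⊆ A₁[t] ⊆ Λ₁` and the local rings of `A₁[t]` and `A₁` at the
centre coincide inside `K` (Novacoski–Spivakovsky 2014, Lemma 2.5 (1): `centreLocalization_le`);
regularity transfers (`isRegularLocalRing_of_centreLocalization_eq`). Finally `t ∈ O` because
`t ^ p ∈ O` and valuation rings are integrally closed.

The small subalgebra helpers are adapted from `Cruxes/LuAlphaPTorsor/Disproof.lean` (§Helpers,
§3b `case_frac`), which is not importable from `Theorems/`.

Log: (1) direct proof via `IsLocalization.lift` + `frobenius_inj` + tree lemmas of
`RankOneReductionProofs.lean` §lifting.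
-/

-- single-problem summit: the doubled namespace component `ResolutionOfSingularities` is forced
set_option linter.dupNamespace false

open IsLocalRing

namespace Summit.ResolutionOfSingularities.ResolutionOfSingularities.Theorems.PfaffLine

open Literature.AlgebraicGeometry.Resolution

section Helpers

variable {k K : Type} [Field k] [Field K] [Algebra k K]

-- adapted from Cruxes/LuAlphaPTorsor/Disproof.lean
/-- Valuation rings are integrally closed, in the only form needed: `t ^ n ∈ O ⇒ t ∈ O`. -/
theorem mem_valuationSubring_of_pow_mem (O : ValuationSubring K) {t : K} {n : ℕ} (hn : n ≠ 0)
    (h : t ^ n ∈ O) : t ∈ O := by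
  rw [← O.valuation_le_one_iff] at h ⊢
  rw [map_pow] at h
  by_contra hlt
  exact (one_lt_pow₀ (lt_of_not_ge hlt) hn).not_ge h

-- adapted from Cruxes/LuAlphaPTorsor/Disproof.lean
/-- `A₁[t] ⊆ S` for a subring `S ⊆ K` as soon as `A₁ ⊆ S` and `t ∈ S`. -/
theorem adjoin_insert_toSubring_le (S : Subring K) (A₁ : Subalgebra k K)
    (h₁ : A₁.toSubring ≤ S) {t : K} (ht : t ∈ S) :
    (Algebra.adjoin k (insert t (A₁ : Set K))).toSubring ≤ S := by
  let Salg : Subalgebra k K :=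
    { S with algebraMap_mem' := fun c => h₁ (A₁.algebraMap_mem c) }
  change Algebra.adjoin k (insert t (A₁ : Set K)) ≤ Salg
  refine Algebra.adjoin_le ?_
  rintro x (rfl | hx)
  · exact ht
  · exact h₁ hx

-- adapted from Cruxes/LuAlphaPTorsor/Disproof.lean
/-- `A₁ ≤ A₁[t]`. -/
theorem le_adjoin_insert (A₁ : Subalgebra k K) (t : K) :
    A₁ ≤ Algebra.adjoin k (insert t (A₁ : Set K)) :=
  fun _ hx => Algebra.subset_adjoin (Set.mem_insert_of_mem _ hx)

-- adapted from Cruxes/LuAlphaPTorsor/Disproof.lean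
/-- `t ∈ A₁[t]`. -/
theorem mem_adjoin_insert (A₁ : Subalgebra k K) (t : K) :
    t ∈ Algebra.adjoin k (insert t (A₁ : Set K)) :=
  Algebra.subset_adjoin (Set.mem_insert _ _)

-- adapted from Cruxes/LuAlphaPTorsor/Disproof.lean
/-- `A₁[t]` is finitely generated when `A₁` is. -/
theorem fg_adjoin_insert {A₁ : Subalgebra k K} (hfg : A₁.FG) (t : K) :
    (Algebra.adjoin k (insert t (A₁ : Set K))).FG := by
  classical
  obtain ⟨s, rfl⟩ := hfg
  rw [Algebra.adjoin_insert_adjoin, ← Finset.coe_insert]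
  exact Subalgebra.fg_adjoin_finset _

/-- If `Frac (A₁[t]) = K` and `t = a / s` is a fraction of elements of `A₁`, then already
`Frac A₁ = K`. -/
theorem isFractionRing_of_adjoin_of_eq_mul_inv (A₁ : Subalgebra k K) {t a s : K}
    (ha : a ∈ A₁) (hs : s ∈ A₁) (hts : t = a * s⁻¹)
    (hfr : IsFractionRing (Algebra.adjoin k (insert t (A₁ : Set K))) K) :
    IsFractionRing A₁.toSubring K := by
  haveI : IsFractionRing (Algebra.adjoin k (insert t (A₁ : Set K))).toSubring K := hfr
  -- `A₁[t]` lies in the subfield generated by `A₁`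
  have hAF : (Algebra.adjoin k (insert t (A₁ : Set K))).toSubring ≤
      (Subfield.closure (A₁ : Set K)).toSubring :=
    adjoin_insert_toSubring_le _ A₁ (fun x hx => Subfield.subset_closure hx)
      ((Subfield.mem_toSubring _ t).mpr (by
        rw [hts]
        exact mul_mem (Subfield.subset_closure ha) (inv_mem (Subfield.subset_closure hs))))
  apply IsFractionRing.of_field
  intro z
  obtain ⟨x, y, -, rfl⟩ :=
    IsFractionRing.div_surjective (A := (Algebra.adjoin k (insert t (A₁ : Set K))).toSubring) z
  have hz : (x : K) / y ∈ Subfield.closure (A₁ : Set K) := div_mem (hAF x.2) (hAF y.2)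
  rw [Subfield.mem_closure_iff] at hz
  obtain ⟨n, hn, d, hd, hnd⟩ := hz
  have hcl : Subring.closure (A₁ : Set K) = A₁.toSubring := Subring.closure_eq A₁.toSubring
  rw [hcl] at hn hd
  exact ⟨⟨n, hn⟩, ⟨d, hd⟩, hnd.symm⟩

end Helpers

section Main

variable {k K : Type} [Field k] [Field K] [Algebra k K]

/-- **Transport of the `p`-th root to `K`.** If `t ^ p = c ^ p` for some `c` in the abstract
local ring `(A₁)_𝔭` of the base at the centre and `char k = p`, then `t = a / s` with
`a, s ∈ A₁` and `ν(s) = 1` (i.e. `t` lies in the local ring at the centre realised inside `K`):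
push `c` to `K` along the universal map of the localisation and use injectivity of Frobenius
on the field `K`. -/
theorem exists_eq_mul_inv_of_pow_eq {p : ℕ} (hp : p.Prime) [CharP k p] (O : ValuationSubring K)
    (A₁ : Subalgebra k K) (h₁ : A₁.toSubring ≤ O.toSubring) (t : K) (htp : t ^ p ∈ A₁)
    (c : Localization.AtPrime (Ideal.comap (Subring.inclusion h₁) (maximalIdeal O)))
    (hc : algebraMap A₁.toSubring
      (Localization.AtPrime (Ideal.comap (Subring.inclusion h₁) (maximalIdeal O))) ⟨t ^ p, htp⟩ =
        c ^ p) :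
    ∃ a ∈ A₁, ∃ s ∈ A₁, O.valuation s = 1 ∧ t = a * s⁻¹ := by
  -- the universal map `φ : (A₁)_𝔭 → K`
  have hunit : ∀ y : (Ideal.comap (Subring.inclusion h₁) (maximalIdeal O)).primeCompl,
      IsUnit (algebraMap A₁.toSubring K y) := by
    intro y
    refine isUnit_iff_ne_zero.mpr fun hy0 => y.2 ?_
    have hy : (y : A₁.toSubring) = 0 := Subtype.ext hy0
    rw [hy]
    exact Ideal.zero_mem _
  set φ : Localization.AtPrime (Ideal.comap (Subring.inclusion h₁) (maximalIdeal O)) →+* K :=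
    IsLocalization.lift hunit with hφ
  -- `φ c ^ p = t ^ p`, hence `t = φ c`
  haveI : CharP K p := charP_of_injective_algebraMap (algebraMap k K).injective p
  haveI : ExpChar K p := ExpChar.prime hp
  have hφc : φ c ^ p = t ^ p := by
    rw [← map_pow, ← hc, hφ, IsLocalization.lift_eq]
    rfl
  have ht : t = φ c := frobenius_inj K p hφc.symm
  -- `c = a / s`
  obtain ⟨a, s, rfl⟩ := IsLocalization.exists_mk'_eq
    (Ideal.comap (Subring.inclusion h₁) (maximalIdeal O)).primeCompl c
  have hs1 : O.valuation (s : A₁.toSubring) = 1 := (mem_primeCompl_centre_iff O A₁ h₁ s).mp s.2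
  have hs0 : ((s : A₁.toSubring) : K) ≠ 0 := by
    intro h0
    rw [h0, map_zero] at hs1
    exact zero_ne_one hs1
  refine ⟨a, a.2, s, (s : A₁.toSubring).2, hs1, ?_⟩
  have hspec := (IsLocalization.lift_mk'_spec hunit a t s).mp ht.symm
  -- `hspec : (a : K) = (s : K) * t`
  rw [eq_mul_inv_iff_mul_eq₀ hs0]
  change (a : K) = ((s : A₁.toSubring) : K) * t at hspec
  rw [hspec, mul_comm]

/-- **The birational exit** (`stub_birationalExit` of line `pfaff-line-log-final-forms`): if
`t ^ p` is already a `p`-th power in the (regular) local ring of the base `A₁` at the centre,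
then `A := A₁[t]` is a finitely generated model in `O` containing `A₁` and `t`, with
`Frac A = K`, regular at the centre — indeed `t ∈ (A₁)_𝔭 ⊆ K`, so `A₁ ⊆ A₁[t] ⊆ (A₁)_𝔭` and the
two models have the same local ring at the centre (Novacoski–Spivakovsky 2014, Lemma 2.5 (1)). -/
theorem stub_birationalExit :
    ∀ p : ℕ, p.Prime → ∀ (k K : Type) [Field k] [CharP k p] [Field K] [Algebra k K] (O : ValuationSubring K) (A₁ : Subalgebra k K) (h₁ : A₁.toSubring ≤ O.toSubring) (t : K), A₁.FG → ∀ (htp : t ^ p ∈ A₁), IsFractionRing (Algebra.adjoin k (insert t (A₁ : Set K))) K → IsRegularLocalRing (Localization.AtPrime (Ideal.comap (Subring.inclusion h₁) (IsLocalRing.maximalIdeal O))) → (∃ c : Localization.AtPrime (Ideal.comap (Subring.inclusion h₁) (IsLocalRing.maximalIdeal O)), algebraMap A₁.toSubring (Localization.AtPrime (Ideal.comap (Subring.inclusion h₁) (IsLocalRing.maximalIdeal O))) ⟨t ^ p, htp⟩ = c ^ p) → ∃ (A : Subalgebra k K) (h : A.toSubring ≤ O.toSubring), A₁ ≤ A ∧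 t ∈ A ∧ A.FG ∧ IsFractionRing A K ∧ IsRegularLocalRing (Localization.AtPrime (Ideal.comap (Subring.inclusion h) (IsLocalRing.maximalIdeal O))) := by
  intro p hp k K _ _ _ _ O A₁ h₁ t hfg htp hfr hreg hc
  obtain ⟨c, hc⟩ := hc
  classical
  -- `t = a / s` with `a, s ∈ A₁`, `ν(s) = 1`
  obtain ⟨a, ha, s, hs, hs1, hts⟩ := exists_eq_mul_inv_of_pow_eq hp O A₁ h₁ t htp c hc
  -- hence `Frac A₁ = K`
  haveI hfr₁ : IsFractionRing A₁.toSubring K :=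
    isFractionRing_of_adjoin_of_eq_mul_inv A₁ ha hs hts hfr
  set A : Subalgebra k K := Algebra.adjoin k (insert t (A₁ : Set K)) with hA
  haveI : IsFractionRing A.toSubring K := hfr
  have htO : t ∈ O := mem_valuationSubring_of_pow_mem O hp.ne_zero (h₁ htp)
  have hAO : A.toSubring ≤ O.toSubring := adjoin_insert_toSubring_le O.toSubring A₁ h₁ htO
  have hA₁A : A₁ ≤ A := le_adjoin_insert A₁ t
  refine ⟨A, hAO, hA₁A, mem_adjoin_insert A₁ t, fg_adjoin_insert hfg t, hfr, ?_⟩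
  -- the local ring `Λ₁ = (A₁)_𝔭 ⊆ K` contains `t`
  set Λ₁ : Subalgebra A₁.toSubring K := Localization.subalgebra.ofField K
    ((maximalIdeal O).comap (Subring.inclusion h₁)).primeCompl
    (Ideal.primeCompl_le_nonZeroDivisors _) with hΛ₁
  have htΛ : t ∈ Λ₁ := by
    rw [hΛ₁, mem_centreLocalization_iff]
    exact ⟨a, ha, s, hs, hs1, hts⟩
  -- hence `A ⊆ Λ₁` and the local rings of `A` and `A₁` at the centre coincide
  have hAΛ : (A : Set K) ⊆ Λ₁ := by
    intro x hx
    exact adjoin_insert_toSubring_le Λ₁.toSubring A₁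
      (fun y hy => le_centreLocalization O A₁ h₁ hy) htΛ hx
  have heq : ((Localization.subalgebra.ofField K
      ((maximalIdeal O).comap (Subring.inclusion hAO)).primeCompl
      (Ideal.primeCompl_le_nonZeroDivisors _)) : Set K) = Λ₁ :=
    le_antisymm (centreLocalization_le O A A₁ hAO h₁ hAΛ)
      (centreLocalization_le O A₁ A h₁ hAO fun x hx => le_centreLocalization O A hAO (hA₁A hx))
  exact isRegularLocalRing_of_centreLocalization_eq O A A₁ hAO h₁ heq hreg

end Main

end Summit.ResolutionOfSingularities.ResolutionOfSingularities.Theorems.PfaffLine
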